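import Summits.AtomisticToContinuum.BoseEinsteinCondensation.Theses.BECStronglyRayleigh
import Summits.AtomisticToContinuum.BoseEinsteinCondensation.Theorems.BECStronglyRayleighLatticeCoherenceAssembly
import Summits.AtomisticToContinuum.BoseEinsteinCondensation.Theorems.BECStronglyRayleighStableImpliesPairCoherence
import Summits.AtomisticToContinuum.BoseEinsteinCondensation.Theorems.BECStronglyRayleighPairKernelSumRule
import Summits.AtomisticToContinuum.BoseEinsteinCondensation.Theorems.BECStronglyRayleighSectorGroundStatePerron
import Summits.AtomisticToContinuum.BoseEinsteinCondensation.Theorems.BECStronglyRayleighPenaltySelectsSector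
import HarnessLib

/-!
# `Assembly` (item stmt-AtomisticToContinuum-13783 of route BECStronglyRayleigh)

`Assembly := GroundStateStability → InsertionFieldDelocalisation → LatticeToPeriodicBridge →
BoundaryTransferWeak → BoseEinsteinCondensation`.

The route's deciding theorem `closes : KineticLatticeBEC → LatticeToPeriodicBridge →
BoundaryTransferWeak → BoseEinsteinCondensation` is pure logic; the mathematical content of the
assembly is the layer-2 glue `LatticeCoherenceAssembly` (item stmt-AtomisticToContinuum-9680, landed as
`LatticeCoherenceAssembly_proof`): `GroundStateStability → StableImpliesPairCoherence →
InsertionFieldDelocalisation → PairKernelSumRule → SectorGroundStatePerron → PenaltySelectsSector →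
KineticLatticeBEC`, whose four support hypotheses are theorems of the tree
(`StableImpliesPairCoherence_proof`, `PairKernelSumRule_proof`, `SectorGroundStatePerron_proof`,
`PenaltySelectsSector_proof`). Hence
`Assembly = fun hS hI hB hW => closes (LatticeCoherenceAssembly_proof hS h₁ hI h₂ h₃ h₄) hB hW`.
-/

namespace Summit.AtomisticToContinuum.BoseEinsteinCondensation.Theorems

open Summit.AtomisticToContinuum.BoseEinsteinCondensation.Theses.BECStronglyRayleigh

/-- **RP-free lattice BEC from the two cruxes.** Theorem S (`GroundStateStability`) and the
delocalisation bound (`InsertionFieldDelocalisation`) imply the route's target `KineticLatticeBEC`: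
the glue `LatticeCoherenceAssembly_proof` fed with the landed supports
`StableImpliesPairCoherence_proof`, `PairKernelSumRule_proof`, `SectorGroundStatePerron_proof`,
`PenaltySelectsSector_proof`. [folklore] -/
theorem becStronglyRayleigh_kineticLatticeBEC_of (hS : GroundStateStability)
    (hI : InsertionFieldDelocalisation) : KineticLatticeBEC :=
  LatticeCoherenceAssembly_proof hS StableImpliesPairCoherence_proof hI PairKernelSumRule_proof
    SectorGroundStatePerron_proof PenaltySelectsSector_proof

/-- **`Assembly`** (item stmt-AtomisticToContinuum-13783 of route BECStronglyRayleigh, concluded BY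
NAME): `GroundStateStability → InsertionFieldDelocalisation → LatticeToPeriodicBridge →
BoundaryTransferWeak → BoseEinsteinCondensation` — the two cruxes give the target `KineticLatticeBEC`
(`becStronglyRayleigh_kineticLatticeBEC_of`), and the route's deciding theorem `closes` does the
rest. [folklore] -/
theorem becStronglyRayleigh_assembly_proof :
    Summit.AtomisticToContinuum.BoseEinsteinCondensation.Theses.BECStronglyRayleigh.Assembly := by
  unfold Summit.AtomisticToContinuum.BoseEinsteinCondensation.Theses.BECStronglyRayleigh.Assembly
  intro hS hI hB hW
  exact closes (becStronglyRayleigh_kineticLatticeBEC_of hS hI) hB hW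

end Summit.AtomisticToContinuum.BoseEinsteinCondensation.Theorems
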